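/-
Copyright: the b2b-balaban cell (near-miss cell 7), T⁴-continuum fan-out, lineage t4-ne7b-p1 (node U5c COUNT member).
Released under the licence of the surrounding project.
-/
import Summits.QuantumFields.BalabanUV.T4Continuum.Support.Crowding
import Summits.QuantumFields.BalabanUV.T4Continuum.Support.CrowdingAnalysisTwo

/-!
# Crowding, fatness-weighted (crowding theorem, part 3′): the zone driver weighs a birth by its class

Summits-side support leaf of the T⁴-continuum cell (rung (B)+1 on a FINITE torus only; NOT infinite volume, NOT the
mass gap, NOT the Clay statement; NOT a proof of the spine estimate NE7b).  Lineage `t4-ne7b-p1`, node U5c, wall (GM),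
located item G-ne7bp1g18-2 part (II).  [folklore] finite combinatorics ∕ real analysis over the cell's OWN carrier
(`T4PersistenceDictionary.Gen PEv`); nothing is quoted from print; nothing printed is asserted; no `[cite:]` tag.

WHY THE WEIGHT.  In the zone form of the placement assembly the extent of a structure at step `t` is driven by its
RECENT formation events, and a birth of class `d′` enters with its linear size `d′ + 1` (in cubes): the zone driver is
`q_t(Z) = Σ_{births b of Z} (d′_b + 1)·λ^{t − s_b} + Σ_{mergers m of Z} λ^{t − t_m}`, bounded at a merger step `t`
by the discounted WEIGHTED crowding `Q(wcnt G, σ, t)`, `wcnt G t = Σ_{births at t} (d′ + 1) + m_t`, `σ² = λ`.  A cap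
on `d′` is cutoff-dependent (`Dcap K`), so a cutoff-free exit must carry the weight.  The weighted theorem is in fact
EASIER than part 3: the weighted count enters the cost estimate only linearly (`CrowdingAnalysisTwo.cost_le₂`), and a
linear `Σ (d′ + 1)` is exactly what the quadratic birth credit pays; superlinearity is needed only against the
merger multiplicity `m_t`, paid by the younger-root budget of parts 1∕1b (`Crowding.merges_budget`).

THE WEIGHTED CROWDING THEOREM (`crowdingW`).  For a well-formed genealogy `G : Gen PEv` with consistent, ordered step
data and births of kind `0`, for every `p ≥ 0`, `σ ∈ (0,1)`, `ε > 0`, `θ > 0`, with `F = Σ_{b ∈ births G} (d′_b + 1)`: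

  `Σ_{e ∈ merges G} p · log Q(wcnt G, σ, step e)
      ≤ θ·F + ε·partnerAges PEv.step G + crowdA p σ (min(ε,θ)∕8)·(F + #merges G)`,

and, since `#merges G + 1 = #births G ≤ F` (`card_merges_add_one`), the CLASS-LINEAR form (`crowdingW_linear`)
`≤ (θ + 2·crowdA p σ (min(ε,θ)∕8))·F + ε·partnerAges`, with its product form (`prod_rpow_Qw_le`)
`∏_{e ∈ merges G} Q(wcnt G, σ, step e)^p ≤ exp((θ + 2·crowdA)·F) · (exp ε)^{partnerAges}` — the shape consumed by the
count chain: the first factor lowers the quadratic birth constant `a` by `θ + 2·crowdA` (parts 3∕3b, `lowerA`), the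
second multiplies the placement rate `Λ′` by `e^{ε}` (`Λ′e^{−κ₁} ≤ 1` becomes `Λ′e^{ε−κ₁} ≤ 1`).

LOCATED, NOT DONE HERE.  The abstract zone skeleton and `q_Z ≤ Q(wcnt G)` under the chronology of sub-events; the
reading (ID) (G-ne7bp1g9-1); the per-record price (E2)∕(R1) (G-ne7bp1-1); whether print's `a` has the room
`θ + 2·crowdA` (an (E2)-side constant).  NE7b discharge: no date.

HONEST DEPENDENCY (cell): continuum YM on T⁴ ⇐ BetaPertH ∧ nine spine estimates (0/9 proved); BetaPertH ⇐ (D1) ∧ (D4)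
∧ CAP+tail.  This file changes none of it.
-/

namespace Summit.QuantumFields.BalabanUV.T4Continuum.Crowding

open Finset
open Literature.MathematicalPhysics.QuantumFieldTheory.Balaban1983to89
open T4PersistenceDictionary T4PartnerMultiplicity
open Summit.QuantumFields.BalabanUV.T4Continuum.PlacementSkeleton
open Summit.QuantumFields.BalabanUV.T4Continuum.PlacementBatch

noncomputable section

/-! ## §1 The weighted count and the births∕mergers balance -/

/-- THE WEIGHTED COUNT of formation events at step `t`: `wcnt G t = Σ_{births at t} (d′ + 1) + m_t`. [folklore] -/
def wcnt (G : Gen PEv) (t : ℕ) : ℕ := ∑ b ∈ birthsAt (births G) t, (b.fat + 1) + (mergesAt G t).card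

/-- `m_t ≤ wcnt G t` [folklore] -/
theorem card_mergesAt_le_wcnt (G : Gen PEv) (t : ℕ) : (mergesAt G t).card ≤ wcnt G t := Nat.le_add_left _ _

/-- a merger is counted at its own step: `1 ≤ wcnt G (step e)` [folklore] -/
theorem one_le_wcnt_of_mem {G : Gen PEv} {e : PEv} (he : e ∈ merges G) : 1 ≤ wcnt G e.step :=
  have h1 : 1 ≤ (mergesAt G e.step).card := card_pos.2 ⟨e, mem_filter.2 ⟨he, rfl⟩⟩
  le_trans h1 (card_mergesAt_le_wcnt G e.step)

/-- hence `1 ≤ Q(wcnt G, σ, step e)` at every merger [folklore] -/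
theorem one_le_Qw_of_mem {G : Gen PEv} {σ : ℝ} (hσ : 0 ≤ σ) {e : PEv} (he : e ∈ merges G) :
    1 ≤ Q (wcnt G) σ e.step :=
  le_trans (by exact_mod_cast one_le_wcnt_of_mem he) (self_le_Q (wcnt G) hσ e.step)

variable (W : PEv → ℕ)

/-- **BIRTHS AND MERGERS BALANCE**: a well-formed genealogy has exactly one more birth than mergers (binary tree with
fresh, separated events). [folklore] -/
theorem card_merges_add_one : ∀ {G : Gen PEv}, G.WF W → (merges G).card + 1 = (births G).card
  | Gen.born b j, _ => by simp [merges]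
  | Gen.renew G e h, hW => by simpa [merges] using card_merges_add_one (G := G) hW.1
  | Gen.merge X Y e, hW => by
      obtain ⟨heX, heY, hdM, hdB⟩ := merge_facts W hW
      have hXY : e ∉ merges X ∪ merges Y := by simp [heX, heY]
      rw [merges, births_merge, card_insert_of_notMem hXY, card_union_of_disjoint hdM, card_union_of_disjoint hdB,
        ← card_merges_add_one hW.1, ← card_merges_add_one hW.2.1]
      ring

/-- `#merges G ≤ Σ_{births} (d′ + 1)` for a well-formed genealogy [folklore] -/
theorem card_merges_le_fatSum {G : Gen PEv} (hW : G.WF W) :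
    ((merges G).card : ℝ) ≤ ∑ b ∈ births G, ((b.fat : ℝ) + 1) := by
  have h1 : ((merges G).card : ℝ) ≤ (births G).card := by
    exact_mod_cast (Nat.le_succ _).trans (card_merges_add_one W hW).le
  have h2 : ((births G).card : ℝ) ≤ ∑ b ∈ births G, ((b.fat : ℝ) + 1) := by
    have : ∑ b ∈ births G, (1 : ℝ) ≤ ∑ b ∈ births G, ((b.fat : ℝ) + 1) :=
      sum_le_sum fun b _ => le_add_of_nonneg_left (Nat.cast_nonneg _)
    simpa using this
  exact h1.trans h2

/-- `crowdA ≥ 0` for `p ≥ 0`, `σ ∈ (0,1)` [folklore] -/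
theorem crowdA_nonneg {p σ : ℝ} (hp : 0 ≤ p) (h0 : 0 < σ) (h1 : σ < 1) (η : ℝ) : 0 ≤ crowdA p σ η := by
  have hl : Real.log (1 - σ) < 0 := Real.log_neg (by linarith) (by linarith)
  unfold crowdA
  have : 0 ≤ p * (-Real.log (1 - σ)) := by nlinarith
  positivity

/-! ## §2 The weighted totals over the steps -/

/-- `Σ_{t ≤ T} wcnt G t = Σ_{births} (d′ + 1) + #merges G` once every formation event has step `≤ T`. [folklore] -/
theorem sum_wcnt {G : Gen PEv} (hk : ∀ b ∈ births G, b.kind = 0) {T : ℕ}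
    (hTb : ∀ b ∈ births G, b.step ∈ range (T + 1)) (hTm : ∀ e ∈ merges G, e.step ∈ range (T + 1)) :
    ∑ t ∈ range (T + 1), (wcnt G t : ℝ) = ∑ b ∈ births G, ((b.fat : ℝ) + 1) + (merges G).card := by
  have hb : ∑ t ∈ range (T + 1), ∑ b ∈ birthsAt (births G) t, ((b.fat : ℝ) + 1) =
      ∑ b ∈ births G, ((b.fat : ℝ) + 1) := by
    calc ∑ t ∈ range (T + 1), ∑ b ∈ birthsAt (births G) t, ((b.fat : ℝ) + 1)
        = ∑ t ∈ range (T + 1), ∑ b ∈ (births G).filter (fun e => e.step = t), ((b.fat : ℝ) + 1) :=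
          sum_congr rfl fun t _ => by rw [birthsAt_eq_filter hk]
      _ = ∑ b ∈ births G, ((b.fat : ℝ) + 1) := sum_fiberwise_of_maps_to hTb _
  have hm : ∑ t ∈ range (T + 1), ((mergesAt G t).card : ℝ) = (merges G).card := by
    rw [card_eq_sum_card_fiberwise hTm, Nat.cast_sum]
    rfl
  rw [← hb, ← hm, ← sum_add_distrib]
  refine sum_congr rfl fun t _ => ?_
  rw [wcnt]
  push_cast
  rfl

/-! ## §3 The weighted crowding theorem -/

/-- **THE WEIGHTED CROWDING THEOREM.**  For a well-formed genealogy with consistent, ordered step data and births of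
kind `0`, for every `p ≥ 0`, `σ ∈ (0,1)`, `ε > 0`, `θ > 0`:
`Σ_{e ∈ merges G} p·log Q(wcnt G, σ, step e) ≤ θ·F + ε·partnerAges G + crowdA p σ (min(ε,θ)∕8)·(F + #merges G)`,
`F = Σ_{b ∈ births G}(d′_b + 1)`. [folklore] -/
theorem crowdingW {p σ ε θ : ℝ} (hp : 0 ≤ p) (h0 : 0 < σ) (h1 : σ < 1) (hε : 0 < ε) (hθ : 0 < θ)
    {G : Gen PEv} (hW : G.WF W) (hS : StepsOK PEv.step G) (hO : Ordered PEv.step G)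
    (hk : ∀ b ∈ births G, b.kind = 0) :
    ∑ e ∈ merges G, p * Real.log (Q (wcnt G) σ e.step) ≤
      θ * ∑ b ∈ births G, ((b.fat : ℝ) + 1) + ε * (partnerAges PEv.step G : ℝ) +
        crowdA p σ (min ε θ / 8) * (∑ b ∈ births G, ((b.fat : ℝ) + 1) + (merges G).card) := by
  set T := horizon G with hTdef
  have hμ₀ : 0 < min ε θ := lt_min hε hθ
  have hη : 0 < min ε θ / 8 := by positivity
  have hTb : ∀ b ∈ births G, b.step ∈ range (T + 1) := fun b hb => step_mem_range (mem_union_left _ hb)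
  have hTm : ∀ e ∈ merges G, e.step ∈ range (T + 1) := fun e he => step_mem_range (mem_union_right _ he)
  -- (i) regroup the cost by steps (an identity)
  have hi : ∑ e ∈ merges G, p * Real.log (Q (wcnt G) σ e.step) =
      ∑ t ∈ range (T + 1), p * ((mergesAt G t).card : ℕ) * Real.log (Q (wcnt G) σ t) := by
    rw [← sum_fiberwise_of_maps_to hTm]
    refine sum_congr rfl fun t _ => ?_
    rw [sum_congr rfl fun e he => by rw [(mem_filter.1 he).2], sum_const, nsmul_eq_mul, mergesAt]
    ring
  -- (ii) the two-sequence analysis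
  have hii := cost_le₂ hp h0 h1 hη (fun t => (mergesAt G t).card) (wcnt G) (card_mergesAt_le_wcnt G) T
  -- (iii) the merger budget at class rate `2θ` (its `θ/2` is our `θ`)
  have hM := merges_budget W hε.le (by positivity : (0 : ℝ) ≤ 2 * θ) hW hS hO hk hTm
  have e2 : 2 * θ / 2 = θ := by ring
  rw [e2] at hM
  have hiii : 2 * (min ε θ / 8) * ∑ t ∈ range (T + 1), ((mergesAt G t).card : ℝ) * Real.sqrt (mergesAt G t).card ≤
      θ * ∑ b ∈ births G, ((b.fat : ℝ) + 1) + ε * (partnerAges PEv.step G : ℝ) := by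
    refine le_trans ?_ hM
    rw [mul_sum]
    refine sum_le_sum fun t _ => ?_
    set x := ((mergesAt G t).card : ℝ) * Real.sqrt (mergesAt G t).card with hx
    have hx0 : 0 ≤ x := by positivity
    have hs2 : Real.sqrt 2 ≤ 2 := by
      nlinarith [Real.sq_sqrt (show (0 : ℝ) ≤ 2 by norm_num), Real.sqrt_nonneg 2]
    have hdiv : x / 4 ≤ x / (2 * Real.sqrt 2) :=
      div_le_div_of_nonneg_left hx0 (by positivity) (by linarith)
    have hmin : 0 ≤ min ε θ := hμ₀.le
    calc 2 * (min ε θ / 8) * x = min ε θ * (x / 4) := by ring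
      _ ≤ min ε θ * (x / (2 * Real.sqrt 2)) := mul_le_mul_of_nonneg_left hdiv hmin
  -- (iv) the weighted total
  have hiv := sum_wcnt hk hTb hTm
  rw [hi]
  calc ∑ t ∈ range (T + 1), p * ((mergesAt G t).card : ℕ) * Real.log (Q (wcnt G) σ t)
      ≤ 2 * (min ε θ / 8) * ∑ t ∈ range (T + 1), ((mergesAt G t).card : ℝ) * Real.sqrt (mergesAt G t).card +
          crowdA p σ (min ε θ / 8) * ∑ t ∈ range (T + 1), (wcnt G t : ℝ) := hii
    _ ≤ θ * ∑ b ∈ births G, ((b.fat : ℝ) + 1) + ε * (partnerAges PEv.step G : ℝ) +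
          crowdA p σ (min ε θ / 8) * (∑ b ∈ births G, ((b.fat : ℝ) + 1) + (merges G).card) := by
        rw [← hiv]; linarith [hiii]

/-- **CLASS-LINEAR FORM.**  `Σ_{e ∈ merges G} p·log Q(wcnt G, σ, step e) ≤ (θ + 2·crowdA p σ (min(ε,θ)∕8))·F +
ε·partnerAges G`. [folklore] -/
theorem crowdingW_linear {p σ ε θ : ℝ} (hp : 0 ≤ p) (h0 : 0 < σ) (h1 : σ < 1) (hε : 0 < ε) (hθ : 0 < θ)
    {G : Gen PEv} (hW : G.WF W) (hS : StepsOK PEv.step G) (hO : Ordered PEv.step G)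
    (hk : ∀ b ∈ births G, b.kind = 0) :
    ∑ e ∈ merges G, p * Real.log (Q (wcnt G) σ e.step) ≤
      (θ + 2 * crowdA p σ (min ε θ / 8)) * ∑ b ∈ births G, ((b.fat : ℝ) + 1) +
        ε * (partnerAges PEv.step G : ℝ) := by
  have h := crowdingW W hp h0 h1 hε hθ hW hS hO hk
  have hA := crowdA_nonneg hp h0 h1 (min ε θ / 8)
  have hm := card_merges_le_fatSum W hW
  nlinarith [mul_le_mul_of_nonneg_left hm hA]

/-- **PRODUCT FORM** (the shape the count chain consumes):
`∏_{e ∈ merges G} Q(wcnt G, σ, step e)^p ≤ exp((θ + 2·crowdA)·F) · (exp ε)^{partnerAges G}`. [folklore] -/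
theorem prod_rpow_Qw_le {p σ ε θ : ℝ} (hp : 0 ≤ p) (h0 : 0 < σ) (h1 : σ < 1) (hε : 0 < ε) (hθ : 0 < θ)
    {G : Gen PEv} (hW : G.WF W) (hS : StepsOK PEv.step G) (hO : Ordered PEv.step G)
    (hk : ∀ b ∈ births G, b.kind = 0) :
    ∏ e ∈ merges G, Q (wcnt G) σ e.step ^ p ≤
      Real.exp ((θ + 2 * crowdA p σ (min ε θ / 8)) * ∑ b ∈ births G, ((b.fat : ℝ) + 1)) *
        Real.exp ε ^ partnerAges PEv.step G := by
  have hpos : ∀ e ∈ merges G, 0 < Q (wcnt G) σ e.step :=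
    fun e he => lt_of_lt_of_le zero_lt_one (one_le_Qw_of_mem h0.le he)
  have hpos' : ∀ e ∈ merges G, 0 < Q (wcnt G) σ e.step ^ p := fun e he => Real.rpow_pos_of_pos (hpos e he) p
  rw [← Real.exp_nat_mul, ← Real.exp_add, ← Real.exp_log (prod_pos hpos'), Real.exp_le_exp,
    Real.log_prod (hf := fun e he => (hpos' e he).ne')]
  calc ∑ e ∈ merges G, Real.log (Q (wcnt G) σ e.step ^ p) = ∑ e ∈ merges G, p * Real.log (Q (wcnt G) σ e.step) :=
        sum_congr rfl fun e he => Real.log_rpow (hpos e he) p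
    _ ≤ _ := crowdingW_linear W hp h0 h1 hε hθ hW hS hO hk
    _ = _ := by ring

/-! ## §4 Sanity (decided ∕ closed instances; not used elsewhere) -/

namespace Sanity

/-- two births at step `0` of classes `0` and `3` merged at step `0`: weighted count `(0+1) + (3+1) + 1 = 6` -/
theorem wcnt_example :
    wcnt (Gen.merge (Gen.born ((0, 0, 0) : PEv) 0) (Gen.born (0, 0, 3) 0) (0, 2, 0)) 0 = 6 := by decide

/-- and the balance `#merges + 1 = #births` there: `1 + 1 = 2` -/
theorem balance_example :
    (merges (Gen.merge (Gen.born ((0, 0, 0) : PEv) 0) (Gen.born (0, 0, 3) 0) (0, 2, 0))).card + 1 =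
      (births (Gen.merge (Gen.born ((0, 0, 0) : PEv) 0) (Gen.born (0, 0, 3) 0) (0, 2, 0))).card := by decide

end Sanity

end

end Summit.QuantumFields.BalabanUV.T4Continuum.Crowding
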